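import Literature.AlgebraicGeometry.HodgeTheory.BettiUniverseAxioms
import Literature.AlgebraicGeometry.HodgeTheory.SignSymmetricOrbitDataAssembly

/-!
# K1-B stub ALG (route `SignSymmetricPowers`, item stmt-HodgeConjecture-19716) — the orbit-data assembly

Discharges the registered stub `stub_signOrbitData` (skeleton v9 `7018fd20b5a2f68f`, K1-B line
`andre-zariski`, WANTED P3-W7) of the crux `VeryGeneralSignCommutatorsInHg` (rank 2) of
`route-HodgeConjecture-SignSymmetricPowers`; landed `--supports stmt-HodgeConjecture-19716` (it does not
close the item: the GEO stub, the nodal forms and the fact binders remain). Sorry-free; axioms `propext`,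
`Classical.choice`, `Quot.sound`. Pure linear algebra — no geometry, no named fact.

## Statement

`stub_signOrbitData` — the registered signature VERBATIM: `V` a finite-dimensional `ℚ`-space, `B`
alternating non-degenerate, `τ² = 1` a `B`-isometry, `Γ ≤ GL(V)` commuting with `τ` and preserving `B`;
three Picard–Lefschetz generators `U_{r_Π}(c₁)`, `U_{r_L}(c₂)`, `U_{δ₀}(c₃) U_{τδ₀}(c₃)` in `Γ`
(`τ r_Π = r_Π`, `τ r_L = -r_L`, `⟨δ₀, τδ₀⟩ = 0`, `cᵢ ≠ 0`), `Γ = ⟨E⟩` with every `e ∈ E` a `Γ`-conjugate of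
one of the three, no `Γ`-invariants, and the two links `⟨r_Π, g δ₀⟩ ≠ 0`, `⟨r_L, g' δ₀⟩ ≠ 0`. THEN, for the
orbit sets `T := {±g r_Π, ±g r_L}`, `D := {±g δ₀, ±g τδ₀}` (`g ∈ Γ`) and
`R_± := {r ∈ T | τ r = ±r} ∪ {δ ± τδ | δ ∈ D}`: clauses C6–C13 of `SignPencilEnvelope` — (C6) each
`r ∈ T` is the centre of a transvection `U_r(c) ∈ Γ`, `c ≠ 0`; (C7) each `δ ∈ D` is `τ`-isotropic and
`U_δ(c) U_{τδ}(c) ∈ Γ`, `c ≠ 0`; (C8/C11) `span R_± = V_±`; (C9/C12) `R_±` is orthogonally connected;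
(C10/C13) `T` contains a centre of each parity.

## Proof

The Literature theorem `signPencil_clauses_of_orbitData`
(`Literature/AlgebraicGeometry/HodgeTheory/SignSymmetricOrbitDataAssembly.lean`: conjugation of
transvection units, `span (T ∪ D) = ⊤` from `(T ∪ D)^⊥ ⊆ V^Γ = 0`, the projectors `½(1 ± τ)`, and the landed
`orthogonallyConnected_of_signSymmetric_orbits{,_neg}`) at `K = ℚ`, `2 ≠ 0`.
-/

-- `Summit.HodgeConjecture.HodgeConjecture.Theorems` is the mandated namespace (single-problem summit), which
-- `linter.dupNamespace` flags; the lakefile turns the linter off tree-wide, restated here for stand-alone checks.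
set_option linter.dupNamespace false

noncomputable section

namespace Summit.HodgeConjecture.HodgeConjecture.Theorems.SignSymmetricPowersSignOrbitData

open Literature.AlgebraicGeometry.Motives Literature.AlgebraicGeometry.HodgeTheory

/-- **K1-B stub ALG** (`SignOrbitData`, registered signature verbatim, skeleton v9 `7018fd20b5a2f68f` of
stmt-HodgeConjecture-19716): the orbit-data assembly — clauses C6–C13 of `SignPencilEnvelope` for the orbit
sets `T := Γ·{±r_Π, ±r_L}`, `D := Γ·{±δ₀, ±τδ₀}` from three Picard–Lefschetz generators in `Γ`, generation of
`Γ` by their conjugates, vanishing of the `Γ`-invariants and the two links. Proof: the Literature theorem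
`signPencil_clauses_of_orbitData` at `K = ℚ`. -/
theorem stub_signOrbitData :
    open Literature.AlgebraicGeometry.Motives Literature.AlgebraicGeometry.HodgeTheory Literature.AlgebraicGeometry.HodgeTheory.BettiUniverse CategoryTheory.Limits in ∀ (V : Type) [AddCommGroup V] [Module ℚ V] [Module.Finite ℚ V] (B : LinearMap.BilinForm ℚ V) (hB : B.IsAlt), B.Nondegenerate → ∀ (τ : V →ₗ[ℚ] V), τ ^ 2 = 1 → (∀ x y, B (τ x) (τ y) = B x y) → ∀ (Γ : Subgroup (V ≃ₗ[ℚ] V)), (∀ g ∈ Γ, ∀ x, g (τ x) = τ (g x)) → (∀ g ∈ Γ, ∀ x y, B (g x) (g y) = B x y) → ∀ (rP rL δ₀ : V) (c₁ c₂ c₃ : ℚ) (E : Set (V ≃ₗ[ℚ] V)), τ rP = rP → τ rL = -rL → B δ₀ (τ δ₀) = 0 → c₁ ≠ 0 → c₂ ≠ 0 → c₃ ≠ 0 → oneParamTransvectionEquiv B (hB rP) c₁ ∈ Γ → oneParamTransvectionEquiv B (hB rL) c₂ ∈ Γ → oneParamTransvectionEquiv B (hB δ₀) c₃ * oneParamTransvectionEquiv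 B (hB (τ δ₀)) c₃ ∈ Γ → Γ = Subgroup.closure E → (∀ e ∈ E, ∃ g ∈ Γ, e = g * oneParamTransvectionEquiv B (hB rP) c₁ * g⁻¹ ∨ e = g * oneParamTransvectionEquiv B (hB rL) c₂ * g⁻¹ ∨ e = g * (oneParamTransvectionEquiv B (hB δ₀) c₃ * oneParamTransvectionEquiv B (hB (τ δ₀)) c₃) * g⁻¹) → (∀ x : V, (∀ g ∈ Γ, g x = x) → x = 0) → (∃ g ∈ Γ, B rP (g δ₀) ≠ 0) → (∃ g ∈ Γ, B rL (g δ₀) ≠ 0) → let T : Set V := {x | ∃ g ∈ Γ, x = g rP ∨ x = -(g rP) ∨ x = g rL ∨ x = -(g rL)}; let D : Set V := {x | ∃ g ∈ Γ, x = g δ₀ ∨ x = -(g δ₀) ∨ x = g (τ δ₀) ∨ x = -(g (τ δ₀))}; let RP : Set V := {r ∈ T | τ r = r} ∪ (fun δ => δ + τ δ) '' D; let RN : Set V := {r ∈ T | τ r = -r} ∪ (fun δ => δ - τ δ) '' D; (∀ r ∈ T, ∃ c : ℚ, c ≠ 0 ∧ oneParamTransvectionEquiv B (hB r) c ∈ Γ)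 ∧ (∀ δ ∈ D, B δ (τ δ) = 0 ∧ ∃ c : ℚ, c ≠ 0 ∧ oneParamTransvectionEquiv B (hB δ) c * oneParamTransvectionEquiv B (hB (τ δ)) c ∈ Γ) ∧ Submodule.span ℚ RP = Module.End.eigenspace τ 1 ∧ (∀ A' ⊆ RP, A'.Nonempty → A' ≠ RP → ∃ r ∈ A', ∃ ρ ∈ RP, ρ ∉ A' ∧ B r ρ ≠ 0) ∧ (RP.Nonempty → ∃ r ∈ T, τ r = r) ∧ Submodule.span ℚ RN = Module.End.eigenspace τ (-1) ∧ (∀ A' ⊆ RN, A'.Nonempty → A' ≠ RN → ∃ r ∈ A', ∃ ρ ∈ RN, ρ ∉ A' ∧ B r ρ ≠ 0) ∧ (RN.Nonempty → ∃ r ∈ T, τ r = -r) := by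
  intro V _ _ _ B hB hBn τ hτ hτB Γ hΓτ hΓB rP rL δ₀ c₁ c₂ c₃ E hrP hrL hδ₀ hc₁ hc₂ hc₃ huP huL huδ hΓE hE
    hinv hlinkP hlinkL
  exact signPencil_clauses_of_orbitData hB hBn two_ne_zero hτ hτB hΓτ hΓB hrP hrL hδ₀ hc₁ hc₂ hc₃ huP huL
    huδ hΓE hE hinv hlinkP hlinkL

end Summit.HodgeConjecture.HodgeConjecture.Theorems.SignSymmetricPowersSignOrbitData

end
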